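import Summits.AtomisticToContinuum.Crystallization.Theorems.ThreeConeCertificateSlackRigidityLocalLimitFieldA
import Summits.AtomisticToContinuum.Crystallization.Theorems.ThreeConeCertificateSlackRigidityLocalLimit
import Literature.MathematicalPhysics.StatisticalMechanics.LocalMatchingCompactness
import Mathlib.MeasureTheory.Integral.DominatedConvergence
import Mathlib.Topology.UniformSpace.HeineCantor
import HarnessLib

/-!
# Line `signed-root-silent-field` (crux `SlackRigidity`, item 11960): the silent local limit

Stub `stub_localLimitField` of the line skeleton: the landed local-limit theorem
`CLayerWitnessLocalLimit.stub_localLimit` (a sequence of `1/3`-separated rooted sets `S_k ∋ 0`,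
not root-matched at `(R, ε)`, with vanishing local `(F, U)`-slack, has a zero-slack local limit
`Y ∋ 0`, unmatched at `(R+1, ε/2)`) with ONE MORE channel: if moreover the local `L²`-masses
`∫_{B̄(0,L)} Φ_{S_k}²` of the smeared fields `Φ_X(y) = Σ_{q ∈ X} K(|y − q|)` (continuous kernel,
`|K(r)| ≤ C_K(1+r)⁻⁴`) vanish in the limit for every `L`, then `Y` is SILENT: `Φ_Y ≡ 0`
(as a `HasSum … 0` at every point).

Proof.
* `abs_tsum_kernel_sub_le_of_ballMatch` — LOCAL MATCHING MOVES THE FIELD LITTLE: given `y` and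
  `θ > 0` there are `ε₁ > 0`, `R'` with `|Φ_X(y) − Φ_{X'}(y)| ≤ θ` whenever the `1/3`-separated
  `X, X'` are two-way `ε₁`-matched on `B̄(0, R')` (uniform tail bound of file A beyond a radius
  `ρ`; injective matching of the finitely many near points — two partners of one point would be
  `2ε₁ < 1/3` apart; modulus of continuity of `K` on `[0, ρ+1]`; packing count `(6ρ+1)³`);
* hence `Φ_{S_{φ k}} → Φ_Y` pointwise along the convergent subsequence of
  `exists_subseq_forall_eventually_ballMatch`; all fields are continuous and bounded by `8788 C_K`,
  so `∫_{B̄(0,L)} Φ_Y² = lim_k ∫_{B̄(0,L)} Φ_{S_{φ k}}² = 0` (dominated convergence on the ball),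
  and the continuous `Φ_Y` vanishes a.e., hence everywhere (`tsum_kernel_eq_zero_of_tendsto`);
* the other five conclusions are transported exactly as in `stub_localLimit`
  (`zero_mem_of_ballMatch`, `star_tight`, `pair_tight`, `not_matched`).

All `[folklore]`.
-/

noncomputable section

open scoped BigOperators Topology
open MeasureTheory Filter Set Metric
open Literature.MathematicalPhysics.StatisticalMechanics
open Summit.AtomisticToContinuum.Crystallization.Theorems.SlackRigidityNegative (E3)
open Summit.AtomisticToContinuum.Crystallization.Theorems.CLayerWitnessLocalLimit
  (norm_le_dist_add_norm zero_mem_of_ballMatch star_tight pair_tight not_matched)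

namespace Summit.AtomisticToContinuum.Crystallization.Theorems.SignedRootLocalLimit

/-! ## Fields of matched separated sets are close -/

/-- **Local matching moves the field little.** For a continuous kernel with `|K r| ≤ C_K(1+r)⁻⁴`,
a point `y` and `θ > 0` there are a tolerance `ε₁ > 0` and a radius `R'` such that any two
`1/3`-separated sets `X, X'` that are two-way `ε₁`-matched on the ball of radius `R'` about `0`
have fields at `y` differing by at most `θ`: the far points of either set contribute less than
`θ/3` (uniform tail bound), the near points of `X'` are matched injectively to near points of `X`
(two partners of one point would be `2ε₁ < 1/3` apart), every unmatched near point of `X` is far,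
and matched terms differ by the modulus of continuity of `K` on `[0, ρ+1]`. [folklore] -/
theorem abs_tsum_kernel_sub_le_of_ballMatch {K : ℝ → ℝ} {CK : ℝ} (hKc : Continuous K)
    (hKd : ∀ r : ℝ, 0 ≤ r → |K r| ≤ CK / (1 + r) ^ 4) (y : E3) {θ : ℝ} (hθ : 0 < θ) :
    ∃ ε₁ : ℝ, 0 < ε₁ ∧ ∃ R' : ℝ, ∀ X X' : Set E3,
      (∀ p ∈ X, ∀ q ∈ X, p ≠ q → (1 / 3 : ℝ) ≤ dist p q) →
      (∀ p ∈ X', ∀ q ∈ X', p ≠ q → (1 / 3 : ℝ) ≤ dist p q) →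
      BallMatch ε₁ R' 0 X X' →
      |∑' q : ↥X, K ‖y - (q : E3)‖ - ∑' q : ↥X', K ‖y - (q : E3)‖| ≤ θ := by
  classical
  have hCK := decay_const_nonneg hKd
  -- the tail radius
  set M₀ : ℝ := CK * 8788 with hM₀
  have hM₀0 : 0 ≤ M₀ := by positivity
  set ρ : ℝ := 3 * M₀ / θ + 1 with hρ
  have hρ1 : 1 ≤ ρ := by
    have : 0 ≤ 3 * M₀ / θ := by positivity
    linarith
  have hρ0 : 0 ≤ ρ := by linarith
  have htail : M₀ / ρ ≤ θ / 3 := by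
    rw [div_le_iff₀ (by linarith)]
    have : θ / 3 * ρ = M₀ + θ / 3 := by
      rw [hρ]; field_simp
    rw [this]
    linarith
  have htail1 : CK * (8788 / (1 + (ρ - 1))) ≤ θ / 3 := by
    have : CK * (8788 / (1 + (ρ - 1))) = M₀ / ρ := by
      rw [hM₀, add_sub_cancel, mul_div_assoc]
    rw [this]; exact htail
  have htail2 : CK * (8788 / (1 + ρ)) ≤ θ / 3 := by
    refine le_trans ?_ htail
    rw [hM₀, mul_div_assoc]
    refine mul_le_mul_of_nonneg_left ?_ hCK
    exact div_le_div_of_nonneg_left (by norm_num) (by linarith) (by linarith)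
  -- the point count in the near zone
  set N : ℝ := (6 * ρ + 1) ^ 3 with hN
  have hN1 : 1 ≤ N := one_le_pow₀ (by linarith)
  have hN0 : 0 < N := by linarith
  -- uniform continuity of `K` on `[0, ρ + 1]`
  obtain ⟨δ₀, hδ₀, hKu⟩ : ∃ δ₀ > 0, ∀ a ∈ Icc (0 : ℝ) (ρ + 1), ∀ b ∈ Icc (0 : ℝ) (ρ + 1),
      dist a b < δ₀ → dist (K a) (K b) < θ / (3 * N) :=
    Metric.uniformContinuousOn_iff.1
      (isCompact_Icc.uniformContinuousOn_of_continuous hKc.continuousOn) _ (by positivity)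
  set ε₁ : ℝ := min (δ₀ / 2) (1 / 7) with hε₁
  have hε₁0 : 0 < ε₁ := lt_min (half_pos hδ₀) (by norm_num)
  have hε₁δ : ε₁ ≤ δ₀ / 2 := min_le_left _ _
  have hε₁7 : ε₁ ≤ 1 / 7 := min_le_right _ _
  refine ⟨ε₁, hε₁0, ‖y‖ + ρ + 1, fun X X' hX hX' hBM => ?_⟩
  -- the near points of `X'`
  have hfin : (X' ∩ closedBall y ρ).Finite :=
    finite_of_forall_le_dist_of_subset_closedBall (by norm_num : (0 : ℝ) < 1 / 3)
      (fun p hp q hq hpq => hX' p hp.1 q hq.1 hpq) inter_subset_right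
  set s' : Finset E3 := hfin.toFinset with hs'
  have hs'mem : ∀ q : E3, q ∈ s' ↔ q ∈ X' ∧ dist q y ≤ ρ := fun q => by
    rw [hs', Set.Finite.mem_toFinset, mem_inter_iff, mem_closedBall]
  -- their partners in `X`
  have hpart : ∀ q ∈ s', ∃ p ∈ X, dist p q ≤ ε₁ := by
    intro q hq
    obtain ⟨hqX', hqy⟩ := (hs'mem q).1 hq
    refine hBM.1 q hqX' ?_
    rw [dist_zero_right]
    linarith [norm_le_dist_add_norm q y]
  choose! pr hprX hprq using hpart
  have hinj : Set.InjOn pr ↑s' := by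
    intro q hq q' hq' hqq'
    by_contra hne
    have h1 := hX' q ((hs'mem q).1 hq).1 q' ((hs'mem q').1 hq').1 hne
    have h2 : dist q q' ≤ dist (pr q) q + dist (pr q') q' := by
      have := dist_triangle q (pr q) q'
      rw [hqq', dist_comm q (pr q')] at this
      rw [hqq']
      linarith
    linarith [hprq q hq, hprq q' hq']
  set P : Finset E3 := s'.image pr with hP
  have hPX : ∀ z ∈ P, z ∈ X := fun z hz => by
    obtain ⟨q, hq, rfl⟩ := Finset.mem_image.1 hz
    exact hprX q hq
  -- the finite parts as finsets of the subtypes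
  set sX : Finset ↥X := P.subtype (· ∈ X) with hsX
  set sX' : Finset ↥X' := s'.subtype (· ∈ X') with hsX'
  have hsumX : ∑ a ∈ sX, K ‖y - (a : E3)‖ = ∑ z ∈ P, K ‖y - z‖ :=
    Finset.sum_subtype_of_mem (fun z => K ‖y - z‖) hPX
  have hsumX' : ∑ a ∈ sX', K ‖y - (a : E3)‖ = ∑ z ∈ s', K ‖y - z‖ :=
    Finset.sum_subtype_of_mem (fun z => K ‖y - z‖) fun z hz => ((hs'mem z).1 hz).1
  have hPsum : ∑ z ∈ P, K ‖y - z‖ = ∑ q ∈ s', K ‖y - pr q‖ := Finset.sum_image hinj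
  -- tail of `X'`: the points off `s'` are at distance `> ρ`
  have htX' : |∑' q : ↥X', K ‖y - (q : E3)‖ - ∑ a ∈ sX', K ‖y - (a : E3)‖| ≤ θ / 3 := by
    refine (abs_tsum_sub_sum_kernel_le hX' hKd y hρ0 sX' fun a ha => ?_).trans htail2
    have ha' : (a : E3) ∉ s' := fun h => ha (Finset.mem_subtype.2 h)
    rw [hs'mem] at ha'
    push Not at ha'
    have := ha' a.2
    rw [dist_comm] at this
    exact this.le
  -- tail of `X`: the points off `P` are at distance `> ρ - 2ε₁ ≥ ρ - 1`
  have htX : |∑' q : ↥X, K ‖y - (q : E3)‖ - ∑ a ∈ sX, K ‖y - (a : E3)‖| ≤ θ / 3 := by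
    refine (abs_tsum_sub_sum_kernel_le hX hKd y (by linarith) sX fun a ha => ?_).trans htail1
    by_contra hlt
    push Not at hlt
    have ha0 : dist (a : E3) 0 ≤ ‖y‖ + ρ + 1 := by
      rw [dist_zero_right]
      have := norm_le_dist_add_norm (a : E3) y
      rw [dist_comm] at this
      linarith
    obtain ⟨q, hqX', haq⟩ := hBM.2 a a.2 ha0
    have hqs' : q ∈ s' := by
      rw [hs'mem]
      refine ⟨hqX', ?_⟩
      have := dist_triangle q (a : E3) y
      rw [dist_comm q (a : E3), dist_comm (a : E3) y] at this
      linarith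
    have hclose : dist (a : E3) (pr q) < 1 / 3 :=
      calc dist (a : E3) (pr q) ≤ dist (a : E3) q + dist (pr q) q := dist_triangle_right _ _ _
        _ ≤ ε₁ + ε₁ := add_le_add haq (hprq q hqs')
        _ < 1 / 3 := by linarith
    have heq : (a : E3) = pr q := by
      by_contra hne
      exact absurd (hX a a.2 (pr q) (hprX q hqs') hne) (not_le.2 hclose)
    exact ha (Finset.mem_subtype.2 (heq ▸ Finset.mem_image_of_mem pr hqs'))
  -- the matched near terms
  have hcard : (s'.card : ℝ) ≤ N := by
    have h := card_le_of_separated_of_dist_le s' y (by norm_num : (0 : ℝ) < 1 / 3) hρ0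
      (fun c hc => ((hs'mem c).1 hc).2)
      (fun c hc d hd hcd => hX' c ((hs'mem c).1 hc).1 d ((hs'mem d).1 hd).1 hcd)
    rw [finrank_euclideanSpace_fin] at h
    convert h using 2
    ring
  have hmid : |∑ q ∈ s', K ‖y - pr q‖ - ∑ q ∈ s', K ‖y - q‖| ≤ θ / 3 := by
    rw [← Finset.sum_sub_distrib]
    refine (Finset.abs_sum_le_sum_abs _ _).trans ?_
    have hterm : ∀ q ∈ s', |K ‖y - pr q‖ - K ‖y - q‖| ≤ θ / (3 * N) := by
      intro q hq
      obtain ⟨-, hqy⟩ := (hs'mem q).1 hq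
      have hq1 : ‖y - q‖ ≤ ρ := by rw [← dist_eq_norm, dist_comm]; exact hqy
      have hd : |‖y - pr q‖ - ‖y - q‖| ≤ ε₁ := by
        refine (abs_norm_sub_norm_le _ _).trans ?_
        have : y - pr q - (y - q) = q - pr q := by abel
        rw [this, ← dist_eq_norm, dist_comm]
        exact hprq q hq
      have hq2 : ‖y - pr q‖ ≤ ρ + 1 := by
        have := abs_le.1 hd
        linarith
      have h := hKu ‖y - pr q‖ ⟨norm_nonneg _, hq2⟩ ‖y - q‖ ⟨norm_nonneg _, by linarith⟩
        (by rw [Real.dist_eq]; linarith)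
      rw [Real.dist_eq] at h
      exact h.le
    calc ∑ q ∈ s', |K ‖y - pr q‖ - K ‖y - q‖| ≤ ∑ q ∈ s', θ / (3 * N) := Finset.sum_le_sum hterm
      _ = s'.card * (θ / (3 * N)) := by rw [Finset.sum_const, nsmul_eq_mul]
      _ ≤ N * (θ / (3 * N)) := mul_le_mul_of_nonneg_right hcard (by positivity)
      _ = θ / 3 := by field_simp
  -- assemble
  rw [hsumX, hPsum] at htX
  rw [hsumX'] at htX'
  calc |∑' q : ↥X, K ‖y - (q : E3)‖ - ∑' q : ↥X', K ‖y - (q : E3)‖|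
      ≤ |∑' q : ↥X, K ‖y - (q : E3)‖ - ∑ q ∈ s', K ‖y - pr q‖| +
          |∑ q ∈ s', K ‖y - pr q‖ - ∑' q : ↥X', K ‖y - (q : E3)‖| := abs_sub_le _ _ _
    _ ≤ θ / 3 + (|∑ q ∈ s', K ‖y - pr q‖ - ∑ q ∈ s', K ‖y - q‖| +
          |∑ q ∈ s', K ‖y - q‖ - ∑' q : ↥X', K ‖y - (q : E3)‖|) :=
        add_le_add htX (abs_sub_le _ _ _)
    _ ≤ θ / 3 + (θ / 3 + θ / 3) := by
        refine add_le_add le_rfl (add_le_add hmid ?_)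
        rw [abs_sub_comm]; exact htX'
    _ = θ := by ring


/-! ## Silence of the local limit -/

/-- **A locally `L²`-null continuous field vanishes.** If the fields of the `1/3`-separated sets
`T k` converge pointwise to the field of the `1/3`-separated `Y` and their local `L²`-masses on
every ball `B̄(0, L)` are eventually `≤ η` for every `η > 0`, then the field of `Y` vanishes
identically (dominated convergence with the uniform bound `8788 C_K` on the ball, then continuity).
[folklore] -/
theorem tsum_kernel_eq_zero_of_tendsto {T : ℕ → Set E3} {Y : Set E3} {K : ℝ → ℝ} {CK : ℝ}
    (hKc : Continuous K) (hKd : ∀ r : ℝ, 0 ≤ r → |K r| ≤ CK / (1 + r) ^ 4)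
    (hsep : ∀ k, ∀ p ∈ T k, ∀ q ∈ T k, p ≠ q → (1 / 3 : ℝ) ≤ dist p q)
    (hYsep : ∀ p ∈ Y, ∀ q ∈ Y, p ≠ q → (1 / 3 : ℝ) ≤ dist p q)
    (hptw : ∀ y : E3, Tendsto (fun k => ∑' q : ↥(T k), K ‖y - (q : E3)‖) atTop
      (𝓝 (∑' q : ↥Y, K ‖y - (q : E3)‖)))
    (hfield : ∀ L η : ℝ, 0 < η → ∀ᶠ k in atTop,
      ∫ y in closedBall (0 : E3) L, (∑' q : ↥(T k), K ‖y - (q : E3)‖) ^ 2 ≤ η) :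
    ∀ y : E3, ∑' q : ↥Y, K ‖y - (q : E3)‖ = 0 := by
  have hcont := continuous_tsum_kernel hYsep hKc hKd
  -- zero local `L²` mass of the limit field
  have hint0 : ∀ L : ℝ, ∫ y in closedBall (0 : E3) L, (∑' q : ↥Y, K ‖y - (q : E3)‖) ^ 2 = 0 := by
    intro L
    have hT : Tendsto (fun k => ∫ y in closedBall (0 : E3) L, (∑' q : ↥(T k), K ‖y - (q : E3)‖) ^ 2)
        atTop (𝓝 (∫ y in closedBall (0 : E3) L, (∑' q : ↥Y, K ‖y - (q : E3)‖) ^ 2)) := by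
      refine tendsto_integral_of_dominated_convergence (fun _ => (CK * 8788) ^ 2)
        (fun k => ?_) ?_ (fun k => ?_) ?_
      · exact ((continuous_tsum_kernel (hsep k) hKc hKd).pow 2).aestronglyMeasurable
      · exact integrableOn_const measure_closedBall_lt_top.ne
      · refine Eventually.of_forall fun y => ?_
        rw [norm_pow, Real.norm_eq_abs]
        exact pow_le_pow_left₀ (abs_nonneg _) (abs_tsum_kernel_le (hsep k) hKd y) 2
      · exact Eventually.of_forall fun y => (hptw y).pow 2
    have hle : ∀ η : ℝ, 0 < η →
        ∫ y in closedBall (0 : E3) L, (∑' q : ↥Y, K ‖y - (q : E3)‖) ^ 2 ≤ η :=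
      fun η hη => le_of_tendsto hT (hfield L η hη)
    have hge : 0 ≤ ∫ y in closedBall (0 : E3) L, (∑' q : ↥Y, K ‖y - (q : E3)‖) ^ 2 :=
      integral_nonneg fun y => sq_nonneg _
    exact le_antisymm (le_of_forall_pos_le_add fun η hη => by rw [zero_add]; exact hle η hη) hge
  -- hence the continuous limit field vanishes almost everywhere, hence everywhere
  have hzero : (fun y : E3 => ∑' q : ↥Y, K ‖y - (q : E3)‖) = fun _ => 0 := by
    refine (Continuous.ae_eq_iff_eq volume hcont continuous_const).1 ?_
    have hall : ∀ n : ℕ, ∀ᵐ y ∂(volume : Measure E3),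
        y ∈ closedBall (0 : E3) n → (∑' q : ↥Y, K ‖y - (q : E3)‖) ^ 2 = 0 := by
      intro n
      have h1 := (setIntegral_eq_zero_iff_of_nonneg_ae (Eventually.of_forall fun y => sq_nonneg _)
        ((hcont.pow 2).continuousOn.integrableOn_compact
          (isCompact_closedBall (0 : E3) n))).1 (hint0 n)
      exact (ae_restrict_iff' measurableSet_closedBall).1 h1
    filter_upwards [ae_all_iff.2 hall] with y hy
    obtain ⟨n, hn⟩ := exists_nat_ge ‖y‖
    exact (pow_eq_zero_iff two_ne_zero).1 (hy n (mem_closedBall_zero_iff.2 hn))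
  exact fun y => congrFun hzero y

/-! ## The stub -/

/-- **Stub `stub_localLimitField` of line `signed-root-silent-field` (crux `SlackRigidity`) — the
local limit is zero-slack, SILENT and unmatched.**  The landed local-limit theorem
`CLayerWitnessLocalLimit.stub_localLimit` with two more hypotheses (a continuous kernel
`|K(r)| ≤ C_K(1+r)⁻⁴`; vanishing local field mass along the finite rooted sets `S_k`) and one
more conclusion: the local limit `Y` is SILENT, `Σ_{q ∈ Y} K(|y − q|) = 0` (as a `HasSum`) at
every `y ∈ ℝ³`.  Proof: along the convergent subsequence
(`exists_subseq_forall_eventually_ballMatch`, `δ = 1/3`) the five zero-slack conclusions are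
`zero_mem_of_ballMatch`, `star_tight`, `pair_tight`, `not_matched`; the fields `Φ_{S_k}`
converge to `Φ_Y` pointwise (`abs_tsum_kernel_sub_le_of_ballMatch`: the `(1+r)⁻⁴` tail is
summable over `1/3`-separated sets uniformly, by dyadic shell counting), all fields are bounded
by `8788 C_K` and continuous, so `∫_{B̄(0,L)} Φ_Y² = lim ∫_{B̄(0,L)} Φ_{S_k}² = 0` for every `L`
(dominated convergence) and the continuous `Φ_Y` vanishes identically. [folklore] -/
theorem stub_localLimitField :
  ∀ (P : PeriodicConfiguration 3) (ρ' R ε CK : ℝ) (U K : ℝ → ℝ) (F : Set E3 → ℝ) (S : ℕ → Set E3),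
    0 < ε →
    (∀ r : ℝ, 0 < r → 0 ≤ U r) → ContinuousOn U (Set.Ioi 0) → (∀ T : Set E3, 0 ≤ F T) →
    (∀ ε' : ℝ, 0 < ε' → ∃ η : ℝ, 0 < η ∧ ∀ S' T : Set E3,
      (∀ p ∈ S', ∀ q ∈ S', p ≠ q → (1 / 3 : ℝ) ≤ dist p q) →
      (∀ p ∈ T, ∀ q ∈ T, p ≠ q → (1 / 3 : ℝ) ≤ dist p q) →
      (0 : E3) ∈ S' → (0 : E3) ∈ T → BallMatch η (ρ' + 1) 0 S' T →
      |F (S' ∩ Metric.closedBall 0 ρ') - F (T ∩ Metric.closedBall 0 ρ')| ≤ ε') →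
    Continuous K → (∀ r : ℝ, 0 ≤ r → |K r| ≤ CK / (1 + r) ^ 4) →
    (∀ k, (S k).Finite) →
    (∀ k, ∀ p ∈ S k, ∀ q ∈ S k, p ≠ q → (1 / 3 : ℝ) ≤ dist p q) →
    (∀ k, (0 : E3) ∈ S k) →
    (∀ k, ¬ ∃ A : E3 →ₗᵢ[ℝ] E3,
      (∀ p ∈ P.points, ‖p‖ ≤ R → ∃ q ∈ S k, dist q (A p) ≤ ε) ∧
      (∀ q ∈ S k, ‖q‖ ≤ R → ∃ p ∈ P.points, dist q (A p) ≤ ε)) →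
    (∀ L η : ℝ, 0 < η → ∀ᶠ k in Filter.atTop, ∀ s ∈ S k, ‖s‖ ≤ L →
      F (((fun z => z - s) '' S k) ∩ Metric.closedBall 0 ρ') ≤ η ∧
      ∀ s' ∈ S k, s' ≠ s → ‖s'‖ ≤ L → U (dist s s') ≤ η) →
    (∀ L η : ℝ, 0 < η → ∀ᶠ k in Filter.atTop,
      ∫ y in Metric.closedBall (0 : E3) L, (∑' q : ↥(S k), K ‖y - (q : E3)‖) ^ 2 ≤ η) →
    ∃ Y : Set E3,
      (∀ p ∈ Y, ∀ q ∈ Y, p ≠ q → (1 / 3 : ℝ) ≤ dist p q) ∧ (0 : E3) ∈ Y ∧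
      (∀ y ∈ Y, F (((fun z => z - y) '' Y) ∩ Metric.closedBall 0 ρ') = 0) ∧
      (∀ y ∈ Y, ∀ y' ∈ Y, y ≠ y' → U (dist y y') = 0) ∧
      (∀ y : E3, HasSum (fun q : ↥Y => K ‖y - (q : E3)‖) 0) ∧
      ¬ ∃ A : E3 →ₗᵢ[ℝ] E3,
        (∀ p ∈ P.points, ‖p‖ ≤ R + 1 → ∃ q ∈ Y, dist q (A p) ≤ ε / 2) ∧
        (∀ q ∈ Y, ‖q‖ ≤ R + 1 → ∃ p ∈ P.points, dist q (A p) ≤ ε / 2) := by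
  intro P ρ' R ε CK U K F S hε hU0 hUc hF0 hFc hKc hKd _hSfin hsep h0 hbad hslack hfieldS
  obtain ⟨φ, Y, hφ, hYsep, hlim⟩ :=
    exists_subseq_forall_eventually_ballMatch (by norm_num : (0 : ℝ) < 1 / 3) S hsep
  -- transport the hypotheses along the subsequence `T k := S (φ k)`
  have hsepφ : ∀ k, ∀ p ∈ S (φ k), ∀ q ∈ S (φ k), p ≠ q → (1 / 3 : ℝ) ≤ dist p q :=
    fun k => hsep (φ k)
  have h0φ : ∀ k, (0 : E3) ∈ S (φ k) := fun k => h0 (φ k)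
  have hbadφ : ∀ k, ¬ ∃ A : E3 →ₗᵢ[ℝ] E3,
      (∀ p ∈ P.points, ‖p‖ ≤ R → ∃ q ∈ S (φ k), dist q (A p) ≤ ε) ∧
      (∀ q ∈ S (φ k), ‖q‖ ≤ R → ∃ p ∈ P.points, dist q (A p) ≤ ε) :=
    fun k => hbad (φ k)
  have hslackφ : ∀ L η : ℝ, 0 < η → ∀ᶠ k in atTop, ∀ s ∈ S (φ k), ‖s‖ ≤ L →
      F (((fun z => z - s) '' S (φ k)) ∩ Metric.closedBall 0 ρ') ≤ η ∧
      ∀ s' ∈ S (φ k), s' ≠ s → ‖s'‖ ≤ L → U (dist s s') ≤ η :=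
    fun L η hη => hφ.tendsto_atTop.eventually (hslack L η hη)
  have hfieldφ : ∀ L η : ℝ, 0 < η → ∀ᶠ k in atTop,
      ∫ y in closedBall (0 : E3) L, (∑' q : ↥(S (φ k)), K ‖y - (q : E3)‖) ^ 2 ≤ η :=
    fun L η hη => hφ.tendsto_atTop.eventually (hfieldS L η hη)
  have hlim' : ∀ R' η : ℝ, 0 < η → ∀ᶠ k in atTop,
      BallMatch η R' 0 ((fun k => S (φ k)) k) Y := hlim
  -- pointwise convergence of the fields along the subsequence
  have hptw : ∀ y : E3, Tendsto (fun k => ∑' q : ↥(S (φ k)), K ‖y - (q : E3)‖) atTop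
      (𝓝 (∑' q : ↥Y, K ‖y - (q : E3)‖)) := by
    intro y
    rw [Metric.tendsto_nhds]
    intro θ hθ
    obtain ⟨ε₁, hε₁, R', hclose⟩ := abs_tsum_kernel_sub_le_of_ballMatch hKc hKd y (half_pos hθ)
    filter_upwards [hlim R' ε₁ hε₁] with k hk
    rw [Real.dist_eq]
    exact (hclose _ _ (hsepφ k) hYsep hk).trans_lt (half_lt_self hθ)
  -- silence of the limit
  have hsil : ∀ y : E3, ∑' q : ↥Y, K ‖y - (q : E3)‖ = 0 :=
    tsum_kernel_eq_zero_of_tendsto (T := fun k => S (φ k)) hKc hKd hsepφ hYsep hptw hfieldφ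
  refine ⟨Y, hYsep, zero_mem_of_ballMatch hYsep h0φ hlim', fun y hy => ?_,
    fun y hy y' hy' hne => ?_, fun y => ?_, not_matched (T := fun k => S (φ k)) hε hbadφ hlim'⟩
  · exact star_tight (T := fun k => S (φ k)) hF0 hFc hsepφ hYsep hlim'
      (fun L η hη => (hslackφ L η hη).mono fun k hk s hs hsL => (hk s hs hsL).1) hy
  · exact pair_tight (T := fun k => S (φ k)) hU0 hUc hYsep hlim'
      (fun L η hη => (hslackφ L η hη).mono fun k hk s hs hsL => (hk s hs hsL).2) hy hy' hne
  · rw [← hsil y]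
    exact (summable_kernel_of_separated Y K CK y hYsep hKd).hasSum

end Summit.AtomisticToContinuum.Crystallization.Theorems.SignedRootLocalLimit

end
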